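import Mathlib

/-!
# Theorem Q glue, I: lex-greedy sets, the product lemma, chart shadows and the chart decomposition

Abstract setting for Theorem Q (quasi-polynomial vertex bound on dissociated frames; line `greedy-basis-shadow` of crux
stmt-ValiantsHypothesis-5905 `NewtonUnitEquations.DissociatedUniform`): a finite set `E`, vectors `x : E → ℂ^k` and
real heights / planar coordinates on `E`.
* Part Q0 `ncard_lexGreedy_le_rank` — the LEX-GREEDY set `{e ∈ E | x e ∉ span {x e' : h e < h e'}}` of an injective
  height has at most `k` elements (its vectors are independent: the lowest nonzero coefficient would be spanned by
  strictly higher elements).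
* Part Q1 `lexGreedy_prod_split` — on a product configuration `E₁ ×ˢ E₂` with Hadamard-product vectors and added
  heights, a greedy pair has greedy components (push a dependence through `y ↦ y * x₂ e₂`).
* `QuasiPoly.gE`, `QuasiPoly.chartShadow` (greedy elements along a pencil `λ ↦ u + λ v`), `QuasiPoly.cshadow` (greedy
  elements over all injective planar directions), and the chart decomposition `QuasiPoly.ncard_cshadow_le_charts`:
  every injective direction is a positive multiple of `(±1, λ)` or `(0, ±1)` (or `E` is a subsingleton), so
  `|cshadow| ≤ |chart₊| + |chart₋| + 2k + 1`.
[folklore: greedy bases of a matroid]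
-/

-- `Summit.ValiantsHypothesis.ValiantsHypothesis.…` is the tree's mandated single-conjunct layout (Sub = Summit).
set_option linter.dupNamespace false

namespace Summit.ValiantsHypothesis.ValiantsHypothesis.Theorems.NewtonUnitEquationsDissociatedUniform

open scoped BigOperators



namespace GreedyCard

variable {α : Type} {k : ℕ}

/-- The vectors of a lex-greedy set are linearly independent (family indexed by a finset inside the greedy set).
[folklore] -/
theorem linearIndependent_of_subset_greedy (E : Finset α) (x : α → Fin k → ℂ) (h : α → ℝ)
    (hinj : Set.InjOn h E) (G : Finset α)
    (hG : ∀ e ∈ G, e ∈ E ∧ x e ∉ Submodule.span ℂ (x '' {e' : α | e' ∈ E ∧ h e < h e'})) :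
    LinearIndependent ℂ (fun e : G => x e) := by
  classical
  rw [Fintype.linearIndependent_iff]
  intro g hsum
  by_contra hne
  push Not at hne
  -- the lowest element with a nonzero coefficient
  obtain ⟨i₀, hi₀mem, hi₀min⟩ := Finset.exists_min_image (Finset.univ.filter fun i : G => g i ≠ 0)
    (fun i => h i) (by
      obtain ⟨i, hi⟩ := hne
      exact ⟨i, Finset.mem_filter.mpr ⟨Finset.mem_univ _, hi⟩⟩)
  have hg₀ : g i₀ ≠ 0 := (Finset.mem_filter.mp hi₀mem).2
  have hi₀E : (i₀ : α) ∈ E := (hG i₀ i₀.2).1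
  -- isolate `x i₀`
  have hsplit : g i₀ • x i₀ = -∑ i ∈ Finset.univ.erase i₀, g i • x (i : α) := by
    rw [← Finset.add_sum_erase Finset.univ (fun i : G => g i • x (i : α)) (Finset.mem_univ i₀)] at hsum
    exact eq_neg_of_add_eq_zero_left hsum
  have hx : x i₀ = (g i₀)⁻¹ • -∑ i ∈ Finset.univ.erase i₀, g i • x (i : α) := by
    rw [← hsplit, smul_smul, inv_mul_cancel₀ hg₀, one_smul]
  -- every term of the sum lies in the span of strictly higher vectors
  have hmem : x i₀ ∈ Submodule.span ℂ (x '' {e' : α | e' ∈ E ∧ h i₀ < h e'}) := by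
    rw [hx]
    refine Submodule.smul_mem _ _ (Submodule.neg_mem _ (Submodule.sum_mem _ fun i hi => ?_))
    by_cases hgi : g i = 0
    · rw [hgi, zero_smul]; exact Submodule.zero_mem _
    · refine Submodule.smul_mem _ _ (Submodule.subset_span ⟨(i : α), ⟨(hG i i.2).1, ?_⟩, rfl⟩)
      have hle : h i₀ ≤ h i := hi₀min i (Finset.mem_filter.mpr ⟨Finset.mem_univ _, hgi⟩)
      refine lt_of_le_of_ne hle fun heq => ?_
      have : (i₀ : α) = (i : α) := hinj hi₀E (hG i i.2).1 heq
      exact (Finset.mem_erase.mp hi).1 (Subtype.ext this).symm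
  exact (hG i₀ i₀.2).2 hmem

end GreedyCard

/-- **Theorem Q, part Q0.**  A lex-greedy set of a vector configuration in `ℂ^k` with heights injective on `E`
has at most `k` elements. [folklore] -/
theorem ncard_lexGreedy_le_rank (α : Type) (k : ℕ) (E : Finset α) (x : α → Fin k → ℂ) (h : α → ℝ) (hinj : Set.InjOn h E) :
    {e : α | e ∈ E ∧ x e ∉ Submodule.span ℂ (x '' {e' : α | e' ∈ E ∧ h e < h e'})}.ncard ≤ k := by
  classical
  set G : Finset α := E.filter fun e => x e ∉ Submodule.span ℂ (x '' {e' : α | e' ∈ E ∧ h e < h e'}) with hGdef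
  have hset : {e : α | e ∈ E ∧ x e ∉ Submodule.span ℂ (x '' {e' : α | e' ∈ E ∧ h e < h e'})} = (G : Set α) := by
    ext e; simp [hGdef]
  rw [hset, Set.ncard_coe_finset]
  have hG : ∀ e ∈ G, e ∈ E ∧ x e ∉ Submodule.span ℂ (x '' {e' : α | e' ∈ E ∧ h e < h e'}) :=
    fun e he => by simpa [hGdef] using he
  have hli := GreedyCard.linearIndependent_of_subset_greedy E x h hinj G hG
  have := hli.fintype_card_le_finrank
  simpa using this



namespace GreedySplit

variable {α β : Type} {k : ℕ}

/-- Pushing a membership in the span of higher FIRST components through `y ↦ y * c`. [folklore] -/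
theorem mul_mem_span_of_mem_span_fst (E₁ : Finset α) (E₂ : Finset β) (x₁ : α → Fin k → ℂ) (x₂ : β → Fin k → ℂ)
    (h₁ : α → ℝ) (h₂ : β → ℝ) {e₁ : α} {e₂ : β} (he₂ : e₂ ∈ E₂)
    (hmem : x₁ e₁ ∈ Submodule.span ℂ (x₁ '' {e' : α | e' ∈ E₁ ∧ h₁ e₁ < h₁ e'})) :
    x₁ e₁ * x₂ e₂ ∈ Submodule.span ℂ ((fun p : α × β => x₁ p.1 * x₂ p.2) ''
      {p' : α × β | p' ∈ E₁ ×ˢ E₂ ∧ h₁ e₁ + h₂ e₂ < h₁ p'.1 + h₂ p'.2}) := by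
  have h := Submodule.mem_map_of_mem (f := LinearMap.mulRight ℂ (x₂ e₂)) hmem
  rw [LinearMap.mulRight_apply, Submodule.map_span] at h
  refine Submodule.span_mono ?_ h
  rintro _ ⟨_, ⟨e', ⟨he'E, hlt⟩, rfl⟩, rfl⟩
  refine ⟨(e', e₂), ⟨Finset.mem_product.mpr ⟨he'E, he₂⟩, by simpa using hlt⟩, ?_⟩
  simp [LinearMap.mulRight_apply]

/-- Pushing a membership in the span of higher SECOND components through `y ↦ c * y`. [folklore] -/
theorem mul_mem_span_of_mem_span_snd (E₁ : Finset α) (E₂ : Finset β) (x₁ : α → Fin k → ℂ) (x₂ : β → Fin k → ℂ)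
    (h₁ : α → ℝ) (h₂ : β → ℝ) {e₁ : α} {e₂ : β} (he₁ : e₁ ∈ E₁)
    (hmem : x₂ e₂ ∈ Submodule.span ℂ (x₂ '' {e' : β | e' ∈ E₂ ∧ h₂ e₂ < h₂ e'})) :
    x₁ e₁ * x₂ e₂ ∈ Submodule.span ℂ ((fun p : α × β => x₁ p.1 * x₂ p.2) ''
      {p' : α × β | p' ∈ E₁ ×ˢ E₂ ∧ h₁ e₁ + h₂ e₂ < h₁ p'.1 + h₂ p'.2}) := by
  have h := Submodule.mem_map_of_mem (f := LinearMap.mulLeft ℂ (x₁ e₁)) hmem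
  rw [LinearMap.mulLeft_apply, Submodule.map_span] at h
  refine Submodule.span_mono ?_ h
  rintro _ ⟨_, ⟨e', ⟨he'E, hlt⟩, rfl⟩, rfl⟩
  refine ⟨(e₁, e'), ⟨Finset.mem_product.mpr ⟨he₁, he'E⟩, by simpa using hlt⟩, ?_⟩
  simp [LinearMap.mulLeft_apply]

end GreedySplit

/-- **Theorem Q, part Q1.**  A lex-greedy pair of a product configuration (Hadamard-product vectors, added
heights) has lex-greedy components. [folklore] -/
theorem lexGreedy_prod_split (α β : Type) (k : ℕ) (E₁ : Finset α) (E₂ : Finset β) (x₁ : α → Fin k → ℂ)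
    (x₂ : β → Fin k → ℂ) (h₁ : α → ℝ) (h₂ : β → ℝ) (e₁ : α) (e₂ : β)
    (he : (e₁, e₂) ∈ {p : α × β | p ∈ E₁ ×ˢ E₂ ∧ (fun p : α × β => x₁ p.1 * x₂ p.2) p ∉ Submodule.span ℂ
      ((fun p : α × β => x₁ p.1 * x₂ p.2) '' {p' : α × β | p' ∈ E₁ ×ˢ E₂ ∧ h₁ p.1 + h₂ p.2 < h₁ p'.1 + h₂ p'.2})}) :
    e₁ ∈ {e : α | e ∈ E₁ ∧ x₁ e ∉ Submodule.span ℂ (x₁ '' {e' : α | e' ∈ E₁ ∧ h₁ e < h₁ e'})} ∧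
    e₂ ∈ {e : β | e ∈ E₂ ∧ x₂ e ∉ Submodule.span ℂ (x₂ '' {e' : β | e' ∈ E₂ ∧ h₂ e < h₂ e'})} := by
  obtain ⟨hmem, hnot⟩ := he
  obtain ⟨he₁, he₂⟩ := Finset.mem_product.mp hmem
  refine ⟨⟨he₁, fun h => hnot ?_⟩, ⟨he₂, fun h => hnot ?_⟩⟩
  · exact GreedySplit.mul_mem_span_of_mem_span_fst E₁ E₂ x₁ x₂ h₁ h₂ he₂ h
  · exact GreedySplit.mul_mem_span_of_mem_span_snd E₁ E₂ x₁ x₂ h₁ h₂ he₁ h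

/-! ## Planar configurations: greedy sets, chart shadows, configuration shadows -/



namespace QuasiPoly

noncomputable section

variable {α β : Type} {k : ℕ}

/-- The lex-greedy set (from the top) of the vector configuration `x` on `E` for the height `h`. -/
def gE (E : Finset α) (x : α → Fin k → ℂ) (h : α → ℝ) : Set α :=
  {e : α | e ∈ E ∧ x e ∉ Submodule.span ℂ (x '' {e' : α | e' ∈ E ∧ h e < h e'})}

/-- Greedy sets lie in `E`. -/
theorem gE_subset (E : Finset α) (x : α → Fin k → ℂ) (h : α → ℝ) : gE E x h ⊆ E := fun _ he => he.1

/-- Greedy sets are finite. -/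
theorem gE_finite (E : Finset α) (x : α → Fin k → ℂ) (h : α → ℝ) : (gE E x h).Finite :=
  (E.finite_toSet).subset (gE_subset E x h)

/-- Part Q0 in `gE` form: a greedy set for an injective height has at most `k` elements. -/
theorem ncard_gE_le (E : Finset α) (x : α → Fin k → ℂ) (h : α → ℝ) (hinj : Set.InjOn h E) :
    (gE E x h).ncard ≤ k :=
  ncard_lexGreedy_le_rank α k E x h hinj

/-- Greedy sets only depend on the strict order of the heights on `E`. -/
theorem gE_congr (E : Finset α) (x : α → Fin k → ℂ) {h h' : α → ℝ}
    (hiff : ∀ e ∈ E, ∀ e' ∈ E, (h e < h e' ↔ h' e < h' e')) : gE E x h = gE E x h' := by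
  ext e
  simp only [gE, Set.mem_setOf_eq]
  constructor
  · rintro ⟨he, hn⟩
    refine ⟨he, fun hm => hn ?_⟩
    have : {e' : α | e' ∈ E ∧ h e < h e'} = {e' : α | e' ∈ E ∧ h' e < h' e'} := by
      ext e'; simp only [Set.mem_setOf_eq]
      exact ⟨fun ⟨h1, h2⟩ => ⟨h1, (hiff e he e' h1).mp h2⟩, fun ⟨h1, h2⟩ => ⟨h1, (hiff e he e' h1).mpr h2⟩⟩
    rw [this]; exact hm
  · rintro ⟨he, hn⟩
    refine ⟨he, fun hm => hn ?_⟩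
    have : {e' : α | e' ∈ E ∧ h e < h e'} = {e' : α | e' ∈ E ∧ h' e < h' e'} := by
      ext e'; simp only [Set.mem_setOf_eq]
      exact ⟨fun ⟨h1, h2⟩ => ⟨h1, (hiff e he e' h1).mp h2⟩, fun ⟨h1, h2⟩ => ⟨h1, (hiff e he e' h1).mpr h2⟩⟩
    rw [← this]; exact hm

/-- Positive rescaling of the height does not change the greedy set. -/
theorem gE_mul_pos (E : Finset α) (x : α → Fin k → ℂ) (g : α → ℝ) {c : ℝ} (hc : 0 < c) :
    gE E x (fun e => c * g e) = gE E x g :=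
  gE_congr E x fun _ _ _ _ => mul_lt_mul_iff_right₀ hc

/-- Injectivity survives a nonzero rescaling. -/
theorem injOn_of_mul (E : Finset α) (g : α → ℝ) (c : ℝ) (h : Set.InjOn (fun e => c * g e) E) :
    Set.InjOn g E := fun a ha b hb hab => h ha hb (by simp only [hab])

/-- The chart shadow: greedy words along the pencil `λ ↦ u + λ v` at injective parameters. -/
def chartShadow (E : Finset α) (x : α → Fin k → ℂ) (u v : α → ℝ) : Set α :=
  {e : α | ∃ lam : ℝ, Set.InjOn (fun e => u e + lam * v e) E ∧ e ∈ gE E x (fun e => u e + lam * v e)}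

/-- Chart shadows lie in `E`. -/
theorem chartShadow_subset (E : Finset α) (x : α → Fin k → ℂ) (u v : α → ℝ) : chartShadow E x u v ⊆ E :=
  fun _ ⟨_, _, he⟩ => he.1

/-- Chart shadows are finite. -/
theorem chartShadow_finite (E : Finset α) (x : α → Fin k → ℂ) (u v : α → ℝ) : (chartShadow E x u v).Finite :=
  (E.finite_toSet).subset (chartShadow_subset E x u v)

/-- The planar height in direction `w` of a configuration with coordinates `X, Y`. -/
def lin (X Y : α → ℝ) (w : Fin 2 → ℝ) : α → ℝ := fun e => w 0 * X e + w 1 * Y e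

/-- The configuration shadow: greedy words over all directions whose height is injective on `E`. -/
def cshadow (E : Finset α) (x : α → Fin k → ℂ) (X Y : α → ℝ) : Set α :=
  {e : α | ∃ w : Fin 2 → ℝ, Set.InjOn (lin X Y w) E ∧ e ∈ gE E x (lin X Y w)}

/-- Configuration shadows lie in `E`. -/
theorem cshadow_subset (E : Finset α) (x : α → Fin k → ℂ) (X Y : α → ℝ) : cshadow E x X Y ⊆ E :=
  fun _ ⟨_, _, he⟩ => he.1

/-- Configuration shadows are finite. -/
theorem cshadow_finite (E : Finset α) (x : α → Fin k → ℂ) (X Y : α → ℝ) : (cshadow E x X Y).Finite :=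
  (E.finite_toSet).subset (cshadow_subset E x X Y)

/-- Chart `σ = 1` sits inside the configuration shadow (direction `(1, λ)`). -/
theorem chartShadow_pos_subset (E : Finset α) (x : α → Fin k → ℂ) (X Y : α → ℝ) :
    chartShadow E x X Y ⊆ cshadow E x X Y := by
  rintro e ⟨lam, hinj, he⟩
  have hfun : lin X Y ![1, lam] = fun e => X e + lam * Y e := by
    funext e; simp [lin]
  exact ⟨![1, lam], by rw [hfun]; exact hinj, by rw [hfun]; exact he⟩

/-- Chart `σ = -1` sits inside the configuration shadow (direction `(-1, λ)`). -/
theorem chartShadow_neg_subset (E : Finset α) (x : α → Fin k → ℂ) (X Y : α → ℝ) :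
    chartShadow E x (fun e => -X e) Y ⊆ cshadow E x X Y := by
  rintro e ⟨lam, hinj, he⟩
  have hfun : lin X Y ![-1, lam] = fun e => -X e + lam * Y e := by
    funext e; simp [lin]
  exact ⟨![-1, lam], by rw [hfun]; exact hinj, by rw [hfun]; exact he⟩

/-- **Chart decomposition.**  Every injective direction is a positive multiple of `(1, λ)`, `(-1, λ)`, `(0, 1)` or
`(0, -1)` — or `E` is a subsingleton. -/
theorem cshadow_subset_charts (E : Finset α) (x : α → Fin k → ℂ) (X Y : α → ℝ) :
    cshadow E x X Y ⊆ chartShadow E x X Y ∪ chartShadow E x (fun e => -X e) Y ∪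
      {e : α | Set.InjOn Y E ∧ e ∈ gE E x Y} ∪ {e : α | Set.InjOn (fun e => -Y e) E ∧ e ∈ gE E x (fun e => -Y e)} ∪
      {e : α | e ∈ E ∧ (E : Set α).Subsingleton} := by
  rintro e ⟨w, hinj, he⟩
  rcases lt_trichotomy (w 0) 0 with h0 | h0 | h0
  · -- `w 0 < 0`: chart `σ = -1` with `λ = w 1 / (-w 0)`, scale `-w 0 > 0`
    left; left; left; right
    have hc : 0 < -w 0 := by linarith
    have hw : w 0 ≠ 0 := h0.ne
    have hfun : lin X Y w = fun e => (-w 0) * (-X e + (w 1 / (-w 0)) * Y e) := by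
      funext e; simp only [lin]; field_simp; ring
    refine ⟨w 1 / (-w 0), ?_, ?_⟩
    · exact injOn_of_mul E _ _ (by rw [← hfun]; exact hinj)
    · rw [← gE_mul_pos E x _ hc, ← hfun]; exact he
  · rcases lt_trichotomy (w 1) 0 with h1 | h1 | h1
    · -- `w = (0, w 1)` with `w 1 < 0`: direction `-Y`
      left; right
      have hc : 0 < -w 1 := by linarith
      have hfun : lin X Y w = fun e => (-w 1) * (-Y e) := by
        funext e; simp only [lin, h0]; ring
      refine ⟨?_, ?_⟩
      · exact injOn_of_mul E _ _ (by rw [← hfun]; exact hinj)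
      · rw [← gE_mul_pos E x _ hc, ← hfun]; exact he
    · -- `w = 0`: `E` is a subsingleton
      right
      refine ⟨he.1, fun a ha b hb => hinj ha hb ?_⟩
      simp only [lin, h0, h1, zero_mul, add_zero]
    · -- `w = (0, w 1)` with `w 1 > 0`: direction `Y`
      left; left; right
      have hfun : lin X Y w = fun e => (w 1) * Y e := by
        funext e; simp only [lin, h0]; ring
      refine ⟨?_, ?_⟩
      · exact injOn_of_mul E _ _ (by rw [← hfun]; exact hinj)
      · rw [← gE_mul_pos E x _ h1, ← hfun]; exact he
  · -- `w 0 > 0`: chart `σ = 1` with `λ = w 1 / w 0`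
    left; left; left; left
    have hw : w 0 ≠ 0 := h0.ne'
    have hfun : lin X Y w = fun e => (w 0) * (X e + (w 1 / w 0) * Y e) := by
      funext e; simp only [lin]; field_simp
    refine ⟨w 1 / w 0, ?_, ?_⟩
    · exact injOn_of_mul E _ _ (by rw [← hfun]; exact hinj)
    · rw [← gE_mul_pos E x _ h0, ← hfun]; exact he

/-- Counting form of the chart decomposition. -/
theorem ncard_cshadow_le_charts (E : Finset α) (x : α → Fin k → ℂ) (X Y : α → ℝ) :
    (cshadow E x X Y).ncard ≤ (chartShadow E x X Y).ncard + (chartShadow E x (fun e => -X e) Y).ncard + k + k + 1 := by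
  have hV : ∀ g : α → ℝ, ({e : α | Set.InjOn g E ∧ e ∈ gE E x g}).ncard ≤ k := by
    intro g
    by_cases hg : Set.InjOn g E
    · have : {e : α | Set.InjOn g E ∧ e ∈ gE E x g} = gE E x g := by
        ext e; simp only [Set.mem_setOf_eq]; exact ⟨fun h => h.2, fun h => ⟨hg, h⟩⟩
      rw [this]; exact ncard_gE_le E x g hg
    · have : {e : α | Set.InjOn g E ∧ e ∈ gE E x g} = ∅ := by
        ext e; simp only [Set.mem_setOf_eq, Set.mem_empty_iff_false, iff_false, not_and]; exact fun h => absurd h hg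
      rw [this, Set.ncard_empty]; exact Nat.zero_le _
  have hZ : ({e : α | e ∈ E ∧ (E : Set α).Subsingleton}).ncard ≤ 1 := by
    rw [Set.ncard_le_one ((E.finite_toSet).subset fun e he => he.1)]
    intro a ha b hb
    exact ha.2 ha.1 hb.1
  have hfinU : (chartShadow E x X Y ∪ chartShadow E x (fun e => -X e) Y ∪
      {e : α | Set.InjOn Y E ∧ e ∈ gE E x Y} ∪ {e : α | Set.InjOn (fun e => -Y e) E ∧ e ∈ gE E x (fun e => -Y e)} ∪
      {e : α | e ∈ E ∧ (E : Set α).Subsingleton}).Finite := by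
    refine (E.finite_toSet).subset ?_
    refine Set.union_subset (Set.union_subset (Set.union_subset (Set.union_subset ?_ ?_) ?_) ?_) ?_
    · exact chartShadow_subset E x X Y
    · exact chartShadow_subset E x _ Y
    · exact fun e he => he.2.1
    · exact fun e he => he.2.1
    · exact fun e he => he.1
  calc (cshadow E x X Y).ncard
      ≤ (chartShadow E x X Y ∪ chartShadow E x (fun e => -X e) Y ∪
          {e : α | Set.InjOn Y E ∧ e ∈ gE E x Y} ∪ {e : α | Set.InjOn (fun e => -Y e) E ∧ e ∈ gE E x (fun e => -Y e)} ∪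
          {e : α | e ∈ E ∧ (E : Set α).Subsingleton}).ncard :=
        Set.ncard_le_ncard (cshadow_subset_charts E x X Y) hfinU
    _ ≤ (chartShadow E x X Y).ncard + (chartShadow E x (fun e => -X e) Y).ncard +
          ({e : α | Set.InjOn Y E ∧ e ∈ gE E x Y}).ncard +
          ({e : α | Set.InjOn (fun e => -Y e) E ∧ e ∈ gE E x (fun e => -Y e)}).ncard +
          ({e : α | e ∈ E ∧ (E : Set α).Subsingleton}).ncard := by
        refine (Set.ncard_union_le _ _).trans (add_le_add ?_ le_rfl)
        refine (Set.ncard_union_le _ _).trans (add_le_add ?_ le_rfl)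
        refine (Set.ncard_union_le _ _).trans (add_le_add ?_ le_rfl)
        exact Set.ncard_union_le _ _
    _ ≤ (chartShadow E x X Y).ncard + (chartShadow E x (fun e => -X e) Y).ncard + k + k + 1 := by
        have h1 := hV Y; have h2 := hV (fun e => -Y e)
        omega
end

end QuasiPoly

end Summit.ValiantsHypothesis.ValiantsHypothesis.Theorems.NewtonUnitEquationsDissociatedUniform
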